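import Literature.AlgebraicGeometry.Motives.AlgPointsSeparate
import Literature.AlgebraicGeometry.Motives.SeesawTheorem
import HarnessLib

/-!
# Group-scheme structures detected on geometric points

Let `K` be a field, `Ω ⊇ K` an algebraically closed field and `X → Spec K` a geometrically integral,
separated `K`-scheme locally of finite type (e.g. a projective variety). Given `K`-morphisms
`m : X ×_K X → X`, `e : Spec K → X`, `i : X → X`, **if the induced operations on the `Ω`-valued
points `X(Ω)` satisfy the group axioms, then `(X, m, e, i)` is a `K`-group scheme**
(`GrpObj.ofAlgPoints`): each axiom is an equality of two `K`-morphisms out of `X`, `X ×_K X ×_K X`,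
…, and such morphisms (reduced source of finite type, separated target) are equal as soon as they
agree on `Ω`-points (`SchemeOver.hom_ext_of_forall_algPoints` of `Motives/AlgPointsSeparate`;
the products are again geometrically integral, `Motives/SeesawTheorem.geometricallyIntegral_tensorObj_hom`).
This is how the group law of an elliptic curve `E ⊂ ℙ²_K` is shown to make `E` a group *scheme* once
the addition morphism is known to restrict to the chord–tangent law on points (Silverman, *AEC*,
III.3.6 and Remark 3.6.1; Mumford, *Abelian Varieties*, §4, where all identities between
homomorphisms are checked on points; Görtz–Wedhorn I, Prop. 9.2 / EGA IV 17.9 for the density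
argument). The convenient form `GrpObj.ofAlgPointsOfInjective` takes an injection of `X(Ω)` into an
(additive) group compatible with the three operations — for `E` this is Mathlib's group `E(Ω)` of
nonsingular points — and `AlgPoints.map_mul_eq_add` records that the group structure Mathlib then
puts on `X(Ω) = Hom_K(Spec Ω, X)` (`Hom.group`: `P * Q = ⟨P, Q⟩ ≫ m`) is carried to `+` by that map.

## References

* J. H. Silverman, *The Arithmetic of Elliptic Curves*, 2nd ed., GTM 106 (2009): III.3.6, Remark 3.6.1.
  [SilvermanAEC2009]
* D. Mumford, *Abelian Varieties* (1970), §4. [MumfordAV1970]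
* U. Görtz, T. Wedhorn, *Algebraic Geometry I*, 2nd ed. (2020), Prop. 9.2. [GortzWedhorn2020]

## Design

Namespace `Literature.AlgebraicGeometry.Motives` (the directory of `AlgPoints`/`SchemeOver`). No named
facts: everything is a definition with proofs or a theorem. The instances for `X ⊗ Y` in
`SchemeOver K = Over (Spec K)` (locally of finite type, separated; geometric integrality is
`Motives/SeesawTheorem.geometricallyIntegral_tensorObj_hom`) are stated for general `X Y` so that
iterated products are found by instance search.
-/

noncomputable section

open CategoryTheory AlgebraicGeometry MonoidalCategory CartesianMonoidalCategory Limits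

universe u v

namespace Literature.AlgebraicGeometry.Motives

/-! ### Products of `K`-schemes: permanence of the standing hypotheses -/

section Instances

variable {K : Type u} [Field K] (X Y : SchemeOver K)

/-- `X ×_K Y → Spec K` is locally of finite type if `X → Spec K` and `Y → Spec K` are
(base change and composition; `(X ⊗ Y).hom = pullback.fst ≫ X.hom` is Mathlib `Over.tensorObj_hom`).
[folklore] -/
instance SchemeOver.locallyOfFiniteType_tensorObj_hom [LocallyOfFiniteType X.hom]
    [LocallyOfFiniteType Y.hom] : LocallyOfFiniteType (X ⊗ Y).hom := by
  change LocallyOfFiniteType (pullback.fst X.hom Y.hom ≫ X.hom); infer_instance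

/-- `X ×_K Y → Spec K` is separated if `X → Spec K` and `Y → Spec K` are. [folklore] -/
instance SchemeOver.isSeparated_tensorObj_hom [IsSeparated X.hom] [IsSeparated Y.hom] :
    IsSeparated (X ⊗ Y).hom := by
  change IsSeparated (pullback.fst X.hom Y.hom ≫ X.hom); infer_instance

/-- A geometrically integral `K`-scheme is integral (Mathlib `GeometricallyIntegral.isIntegral_of_subsingleton`,
the base `Spec K` being a point). [folklore] -/
theorem SchemeOver.isIntegral_left [GeometricallyIntegral X.hom] : IsIntegral X.left :=
  GeometricallyIntegral.isIntegral_of_subsingleton X.hom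

/-- A geometrically integral `K`-scheme is reduced. [folklore] -/
theorem SchemeOver.isReduced_left [GeometricallyIntegral X.hom] : IsReduced X.left :=
  have := SchemeOver.isIntegral_left X
  inferInstance

end Instances

/-! ### Group-scheme axioms from the group axioms on `Ω`-points -/

section OfPoints

variable {K : Type u} [Field K] (Ω : Type u) [Field Ω] [Algebra K Ω] [IsAlgClosed Ω]
  {X : SchemeOver K} [GeometricallyIntegral X.hom] [LocallyOfFiniteType X.hom] [IsSeparated X.hom]
  (mul : X ⊗ X ⟶ X) (one : 𝟙_ (SchemeOver K) ⟶ X) (inv : X ⟶ X)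

/-- **A `K`-group-scheme structure is detected on `Ω`-points.** If `m : X ×_K X → X`,
`e : Spec K → X`, `i : X → X` are `K`-morphisms of a geometrically integral separated `K`-scheme of
finite type whose induced operations on `X(Ω)`, `Ω` algebraically closed, satisfy the group axioms,
then `(X, m, e, i)` is a group scheme over `K` (Silverman, *AEC* III.3.6 with Rem. 3.6.1: the group
law of `E` is a morphism, and the axioms hold because they hold on points; the density argument is
Görtz–Wedhorn I Prop. 9.2). [cite: SilvermanAEC2009, III.3.6] -/
@[implicit_reducible]
def GrpObj.ofAlgPoints
    (mul_assoc : ∀ P Q R : AlgPoints X Ω,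
      lift (lift P Q ≫ mul) R ≫ mul = lift P (lift Q R ≫ mul) ≫ mul)
    (one_mul : ∀ P : AlgPoints X Ω, lift (toUnit _ ≫ one) P ≫ mul = P)
    (mul_one : ∀ P : AlgPoints X Ω, lift P (toUnit _ ≫ one) ≫ mul = P)
    (inv_mul : ∀ P : AlgPoints X Ω, lift (P ≫ inv) P ≫ mul = toUnit _ ≫ one)
    (mul_inv : ∀ P : AlgPoints X Ω, lift P (P ≫ inv) ≫ mul = toUnit _ ≫ one) : GrpObj X := by
  haveI := SchemeOver.isReduced_left X
  haveI := SchemeOver.isReduced_left ((X ⊗ X) ⊗ X)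
  exact
  { one := one
    mul := mul
    inv := inv
    one_mul := by
      rw [← cancel_epi (λ_ X).inv, Iso.inv_hom_id]
      refine SchemeOver.hom_ext_of_forall_algPoints Ω fun P ↦ ?_
      have hP : P ≫ (λ_ X).inv = lift (toUnit _) P := by ext <;> simp
      rw [Category.comp_id, reassoc_of% hP, lift_whiskerRight_assoc]
      exact one_mul P
    mul_one := by
      rw [← cancel_epi (ρ_ X).inv, Iso.inv_hom_id]
      refine SchemeOver.hom_ext_of_forall_algPoints Ω fun P ↦ ?_
      have hP : P ≫ (ρ_ X).inv = lift P (toUnit _) := by ext <;> simp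
      rw [Category.comp_id, reassoc_of% hP, lift_whiskerLeft_assoc]
      exact mul_one P
    mul_assoc := by
      refine SchemeOver.hom_ext_of_forall_algPoints Ω fun p ↦ ?_
      have hp : p = lift (lift (p ≫ fst _ _ ≫ fst X X) (p ≫ fst _ _ ≫ snd X X)) (p ≫ snd _ _) := by
        ext <;> simp
      rw [hp, lift_whiskerRight_assoc, lift_lift_associator_hom_assoc, lift_whiskerLeft_assoc]
      exact mul_assoc _ _ _
    left_inv := by
      refine SchemeOver.hom_ext_of_forall_algPoints Ω fun P ↦ ?_
      rw [comp_lift_assoc, Category.comp_id, ← Category.assoc P (toUnit X), comp_toUnit]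
      exact inv_mul P
    right_inv := by
      refine SchemeOver.hom_ext_of_forall_algPoints Ω fun P ↦ ?_
      rw [comp_lift_assoc, Category.comp_id, ← Category.assoc P (toUnit X), comp_toUnit]
      exact mul_inv P }

/-- The multiplication of `GrpObj.ofAlgPoints` is the given `m`. [folklore] -/
theorem GrpObj.ofAlgPoints_mul (h₁ h₂ h₃ h₄ h₅) :
    (GrpObj.ofAlgPoints Ω mul one inv h₁ h₂ h₃ h₄ h₅).mul = mul := rfl

/-- The unit of `GrpObj.ofAlgPoints` is the given `e`. [folklore] -/
theorem GrpObj.ofAlgPoints_one (h₁ h₂ h₃ h₄ h₅) :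
    (GrpObj.ofAlgPoints Ω mul one inv h₁ h₂ h₃ h₄ h₅).one = one := rfl

/-- The inverse of `GrpObj.ofAlgPoints` is the given `i`. [folklore] -/
theorem GrpObj.ofAlgPoints_inv (h₁ h₂ h₃ h₄ h₅) :
    (GrpObj.ofAlgPoints Ω mul one inv h₁ h₂ h₃ h₄ h₅).inv = inv := rfl

variable {Ω mul one inv} in
/-- **Group-scheme structure from an embedding of `X(Ω)` into a group.** If an injection
`φ : X(Ω) ↪ G` into an additive group carries `(P, Q) ↦ ⟨P, Q⟩ ≫ m` to `+`, `e` to `0` and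
`P ↦ P ≫ i` to negation, then `(X, m, e, i)` is a `K`-group scheme — the case of an elliptic curve
`E ⊂ ℙ²_K` with `G = E(Ω)` Mathlib's group of nonsingular points (Silverman, *AEC* III.2–III.3.6).
[cite: SilvermanAEC2009, III.3.6] -/
@[implicit_reducible]
def GrpObj.ofAlgPointsOfInjective {G : Type v} [AddGroup G] (φ : AlgPoints X Ω → G)
    (hφ : Function.Injective φ) (map_mul : ∀ P Q : AlgPoints X Ω, φ (lift P Q ≫ mul) = φ P + φ Q)
    (map_one : φ (toUnit _ ≫ one) = 0) (map_inv : ∀ P : AlgPoints X Ω, φ (P ≫ inv) = -φ P) :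
    GrpObj X :=
  GrpObj.ofAlgPoints Ω mul one inv
    (fun P Q R ↦ hφ <| by rw [map_mul, map_mul, map_mul, map_mul, add_assoc])
    (fun P ↦ hφ <| by rw [map_mul, map_one, zero_add])
    (fun P ↦ hφ <| by rw [map_mul, map_one, add_zero])
    (fun P ↦ hφ <| by rw [map_mul, map_inv, map_one, neg_add_cancel])
    (fun P ↦ hφ <| by rw [map_mul, map_inv, map_one, add_neg_cancel])

/-- The multiplication of `GrpObj.ofAlgPointsOfInjective` is the given `m`. [folklore] -/
theorem GrpObj.ofAlgPointsOfInjective_mul {G : Type v} [AddGroup G] (φ : AlgPoints X Ω → G)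
    (hφ : Function.Injective φ) (h₁ : ∀ P Q : AlgPoints X Ω, φ (lift P Q ≫ mul) = φ P + φ Q)
    (h₂ : φ (toUnit _ ≫ one) = 0) (h₃ : ∀ P : AlgPoints X Ω, φ (P ≫ inv) = -φ P) :
    (GrpObj.ofAlgPointsOfInjective φ hφ h₁ h₂ h₃).mul = mul := rfl

/-- The unit of `GrpObj.ofAlgPointsOfInjective` is the given `e`. [folklore] -/
theorem GrpObj.ofAlgPointsOfInjective_one {G : Type v} [AddGroup G] (φ : AlgPoints X Ω → G)
    (hφ : Function.Injective φ) (h₁ : ∀ P Q : AlgPoints X Ω, φ (lift P Q ≫ mul) = φ P + φ Q)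
    (h₂ : φ (toUnit _ ≫ one) = 0) (h₃ : ∀ P : AlgPoints X Ω, φ (P ≫ inv) = -φ P) :
    (GrpObj.ofAlgPointsOfInjective φ hφ h₁ h₂ h₃).one = one := rfl

/-- The inverse of `GrpObj.ofAlgPointsOfInjective` is the given `i`. [folklore] -/
theorem GrpObj.ofAlgPointsOfInjective_inv {G : Type v} [AddGroup G] (φ : AlgPoints X Ω → G)
    (hφ : Function.Injective φ) (h₁ : ∀ P Q : AlgPoints X Ω, φ (lift P Q ≫ mul) = φ P + φ Q)
    (h₂ : φ (toUnit _ ≫ one) = 0) (h₃ : ∀ P : AlgPoints X Ω, φ (P ≫ inv) = -φ P) :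
    (GrpObj.ofAlgPointsOfInjective φ hφ h₁ h₂ h₃).inv = inv := rfl

end OfPoints

/-! ### The induced group structure on `L`-points -/

section Points

open scoped MonObj

variable {K : Type u} [Field K] {X : SchemeOver K} [GrpObj X] {L : Type u} [Field L] [Algebra K L]

/-- **A map of `X(L)` to an additive group that carries `⟨P, Q⟩ ≫ m` to `+` is multiplicative-to-additive**
for Mathlib's group structure on `X(L) = Hom_K(Spec L, X)` (`Hom.group`: `P * Q = ⟨P, Q⟩ ≫ m`,
`MonObj.Hom.mul_def`, by `rfl`): `φ (P * Q) = φ P + φ Q` (so a bijective such `φ` is an isomorphism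
`Additive X(L) ≃+ G`, `AlgPoints.addEquivOfBijective`). [folklore] -/
theorem AlgPoints.map_mul_eq_add {G : Type v} [Add G] (φ : AlgPoints X L → G)
    (map_mul : ∀ P Q : AlgPoints X L, φ (lift P Q ≫ μ[X]) = φ P + φ Q) (P Q : AlgPoints X L) :
    φ (P * Q) = φ P + φ Q :=
  map_mul P Q

/-- The additive isomorphism `Additive X(L) ≃+ G` induced by a bijection `X(L) → G` carrying
`⟨P, Q⟩ ≫ m` to `+` (e.g. `E_W(K̄) ≃+ W(K̄)` for the plane cubic of an elliptic curve, Silverman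
*AEC* III.2–3). [folklore] -/
def AlgPoints.addEquivOfBijective {G : Type v} [Add G] (φ : AlgPoints X L → G)
    (hφ : Function.Bijective φ)
    (map_mul : ∀ P Q : AlgPoints X L, φ (lift P Q ≫ μ[X]) = φ P + φ Q) :
    Additive (AlgPoints X L) ≃+ G :=
  { Equiv.ofBijective (fun P ↦ φ (Additive.toMul P)) (by
      refine ⟨fun P Q h ↦ ?_, fun g ↦ ?_⟩
      · exact Additive.toMul.injective (hφ.1 h)
      · obtain ⟨P, rfl⟩ := hφ.2 g
        exact ⟨Additive.ofMul P, rfl⟩) with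
    map_add' := fun P Q ↦ map_mul (Additive.toMul P) (Additive.toMul Q) }

/-- `AlgPoints.addEquivOfBijective φ _ _ P = φ P`. [folklore] -/
@[simp]
theorem AlgPoints.addEquivOfBijective_apply {G : Type v} [Add G] (φ : AlgPoints X L → G)
    (hφ : Function.Bijective φ) (map_mul) (P : Additive (AlgPoints X L)) :
    AlgPoints.addEquivOfBijective φ hφ map_mul P = φ (Additive.toMul P) := rfl

/-- `(AlgPoints.addEquivOfBijective φ _ _).symm (φ P) = P`. [folklore] -/
@[simp]
theorem AlgPoints.addEquivOfBijective_symm_apply {G : Type v} [Add G] (φ : AlgPoints X L → G)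
    (hφ : Function.Bijective φ) (map_mul) (P : AlgPoints X L) :
    (AlgPoints.addEquivOfBijective φ hφ map_mul).symm (φ P) = Additive.ofMul P :=
  (AlgPoints.addEquivOfBijective φ hφ map_mul).injective (by simp)

end Points

end Literature.AlgebraicGeometry.Motives
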